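import Summits.CriticalPhenomena.CardyFormulaZ2.Theorems.CardyComplexConeEdgePrecompactUFRSTwoArcSurround
import Summits.CriticalPhenomena.CardyFormulaZ2.Theorems.CardyComplexConeEdgePrecompactUFRSTwoArcExcursion

/-!
# The hop between the two exits: a unit-step staircase and its metric bounds
(line `qkz-strip-boundary-arm` of crux `CardyComplexCone.EdgePrecompact`, stmt-CriticalPhenomena-11387;
lattice tool for the START-pair residual of `ufrs_initialContactCase_certJ` / `ufrs_slippedReturnCase_certJ`)

The two explorations of the START pair exit at translate corners; in the medial frame their positions differ by
`w̃ = mshift w`. The HOP `hopPath w̃` is the monotone unit-step staircase from `0` to `w̃` (first horizontal, then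
vertical); translated to the exit position it closes the LASSO of the two continuations. This file: the hop is a
unit-step path from `0` to `w̃` inside the box of `w̃` (`hopPath_zero_ST`, `hopPath_end_ST`, `hopPath_step_ST`,
`hopPath_snd_ST`, `hopPath_natAbs_le_ST`), and its plane picture stays within `δ (|w̃₁| + |w̃₂|)` of its start
(`dist_psiC_hop_le_ST`, registered anchor `ufrs_hopNear_ST`).

References: S. Smirnov, Ann. of Math. 172 (2010), §4 (the medial lattice).
-/

set_option linter.unusedSimpArgs false

namespace Summit.CriticalPhenomena.CardyFormulaZ2.Cruxes.EdgePrecompact.QkzStripBoundaryArm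

open MeasureTheory Filter Set Metric
open Literature.Probability.LatticeModels Literature.Probability.LatticeModels.MedialTrail
open scoped BigOperators

noncomputable section

/-! ## The hop -/

/-- **The hop**: a unit-step staircase from `0` to `w`, first `|w.1|` horizontal steps, then `|w.2|` vertical
ones. -/
def hopPath (w : Pt) (k : ℕ) : Pt :=
  if k ≤ w.1.natAbs then ((if 0 ≤ w.1 then (k : ℤ) else -(k : ℤ)), 0)
  else (w.1, if 0 ≤ w.2 then (k : ℤ) - w.1.natAbs else (w.1.natAbs : ℤ) - k)

/-- The hop starts at `0`. -/
theorem hopPath_zero_ST (w : Pt) : hopPath w 0 = 0 := by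
  unfold hopPath; rw [if_pos (Nat.zero_le _)]; split_ifs <;> rfl

/-- The hop ends at `w`. -/
theorem hopPath_end_ST (w : Pt) : hopPath w (w.1.natAbs + w.2.natAbs) = w := by
  unfold hopPath
  split_ifs <;> refine Prod.ext ?_ ?_ <;> simp only <;> omega

/-- The hop is a unit-step path. -/
theorem hopPath_step_ST (w : Pt) (k : ℕ) : IsUnitStep (hopPath w k) (hopPath w (k + 1)) := by
  unfold hopPath IsUnitStep
  split_ifs <;> simp only <;> (try simp only [true_and, and_true, true_or, or_true]) <;> omega

/-- The rows of the hop are between `0` and `w.2`. -/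
theorem hopPath_snd_ST (w : Pt) {k : ℕ} (hk : k ≤ w.1.natAbs + w.2.natAbs) :
    min 0 w.2 ≤ (hopPath w k).2 ∧ (hopPath w k).2 ≤ max 0 w.2 := by
  unfold hopPath
  split_ifs <;> simp only [le_max_iff, min_le_iff] <;> omega

/-! ## The hop stays near its start -/

/-- Translating a medial point by `q` moves its plane picture by at most `δ (|q₁| + |q₂|)`. -/
theorem dist_psiC_add_le_ST {δ : ℝ} (hδ : 0 ≤ δ) (p q : Pt) :
    dist (psiC δ (p + q)) (psiC δ p) ≤ δ * (|((q.1 : ℤ) : ℝ)| + |((q.2 : ℤ) : ℝ)|) := by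
  rw [Complex.dist_eq]
  refine (Complex.norm_le_abs_re_add_abs_im _).trans ?_
  have hre : (psiC δ (p + q) - psiC δ p).re = δ / 2 * ((q.1 : ℝ) - q.2) := by
    rw [Complex.sub_re, psiC_re, psiC_re]; simp only [Prod.fst_add, Prod.snd_add]; push_cast; ring
  have him : (psiC δ (p + q) - psiC δ p).im = δ / 2 * ((q.1 : ℝ) + q.2) := by
    rw [Complex.sub_im, psiC_im, psiC_im]; simp only [Prod.fst_add, Prod.snd_add]; push_cast; ring
  rw [hre, him, abs_mul, abs_mul, abs_of_nonneg (by positivity : (0:ℝ) ≤ δ / 2)]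
  have h1 : |((q.1 : ℝ)) - q.2| ≤ |(q.1 : ℝ)| + |(q.2 : ℝ)| := abs_sub _ _
  have h2 : |((q.1 : ℝ)) + q.2| ≤ |(q.1 : ℝ)| + |(q.2 : ℝ)| := abs_add_le _ _
  nlinarith [abs_nonneg ((q.1 : ℝ)), abs_nonneg ((q.2 : ℝ))]

/-- The hop stays in the box of its displacement. -/
theorem hopPath_natAbs_le_ST (w : Pt) (k : ℕ) (hk : k ≤ w.1.natAbs + w.2.natAbs) :
    (hopPath w k).1.natAbs ≤ w.1.natAbs ∧ (hopPath w k).2.natAbs ≤ w.2.natAbs := by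
  unfold hopPath; split_ifs <;> simp only <;> omega

/-- The plane picture of a hop point is within `δ (|w₁| + |w₂|)` of the start. -/
theorem dist_psiC_hop_le_ST {δ : ℝ} (hδ : 0 ≤ δ) (p w : Pt) (k : ℕ) (hk : k ≤ w.1.natAbs + w.2.natAbs) :
    dist (psiC δ (p + hopPath w k)) (psiC δ p) ≤ δ * (w.1.natAbs + w.2.natAbs : ℕ) := by
  refine (dist_psiC_add_le_ST hδ p _).trans ?_
  obtain ⟨h1, h2⟩ := hopPath_natAbs_le_ST w k hk
  have e1 : |(((hopPath w k).1 : ℤ) : ℝ)| = (((hopPath w k).1.natAbs : ℕ) : ℝ) := by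
    rw [← Int.cast_natCast, Int.natCast_natAbs, Int.cast_abs]
  have e2 : |(((hopPath w k).2 : ℤ) : ℝ)| = (((hopPath w k).2.natAbs : ℕ) : ℝ) := by
    rw [← Int.cast_natCast, Int.natCast_natAbs, Int.cast_abs]
  rw [e1, e2]
  have : (((hopPath w k).1.natAbs : ℕ) : ℝ) + ((hopPath w k).2.natAbs : ℕ) ≤ ((w.1.natAbs + w.2.natAbs : ℕ) : ℝ) := by
    exact_mod_cast Nat.add_le_add h1 h2
  nlinarith

/-- **The hop stays near its start** (registered helper `ufrs_hopNear_ST` of stmt-CriticalPhenomena-11387; explicit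
form of `dist_psiC_hop_le_ST`). -/
theorem ufrs_hopNear_ST : ∀ (δ : ℝ) (p w : MedialTrail.Pt) (k : ℕ), 0 ≤ δ → k ≤ w.1.natAbs + w.2.natAbs → dist (psiC δ (p + hopPath w k)) (psiC δ p) ≤ δ * (w.1.natAbs + w.2.natAbs : ℕ) :=
  fun _ p w k hδ hk => dist_psiC_hop_le_ST hδ p w k hk

end

end Summit.CriticalPhenomena.CardyFormulaZ2.Cruxes.EdgePrecompact.QkzStripBoundaryArm
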